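import Summits.QuantumFields.YangMills.Theorems.UnitScaleTiltProp7TwistedSliceGaugeCorrectionAny
import HarnessLib

/-!
# Route `UnitScaleTilt`, crux «MinimiserStabilityRegPr» (stmt-QuantumFields-19200, stub EX), route (α) — **«SLICE-CHAIN-OF-PLAQSMALL» (px16 g3 LOCATE «H128-CYCLE» 0b50e466fd265af9, cure (C1);
# EX namer ★w2-19200 g7 «(C1) GO» 2026-08-29T00:24:15Z): THE `U′`-REGULARITY HYPOTHESIS OF THE TWISTED-SLICE CHAIN WEAKENED FROM `RegPr ε₀′ U′` TO ITS PLAQUETTE HALF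
# `PlaqSmall (regThreshold F n K ε₀′) U′`** — re-exports with the SAME proofs of ✓`Prop7SymAvgRelDiffT3.{analyticAt_rel_zero, hasFDerivAt_rel, differentiableAt_logChartSym_zero, QSym_gaugeDir}_of_regPr`
# (★w4∕★w5-20520 lineage; they read only `hreg.1`), T2 ✓`Prop7TwistedSliceTangent.fderiv_logChartTwS_apply_eq_zero_iff_of_regPr`, T3 ✓`Prop7TwistedSliceGaugeCorrection.exists_gaugeDir_QSym_velocity_sub_eq_zero_of_slice_tangent`
# and (3′) ✓`Prop7TwistedSliceGaugeCorrectionAny.{QSym_velocity_sub_gaugeDir_eq_zero_of_extends, exists_su2_gaugeDir_QSym_velocity_sub_eq_zero}` (★px5 g3) — statements VERBATIM except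
# `hreg′ ↦ hplaq′` at the chart point `U′` (the background `U₀` keeps `RegPr`); NO landed declaration is edited.  WHY: [Balaban1985Variational] (124)–(126) read only the PLAQUETTE regularity of
# `U₁U₀` ([Balaban1985RegularSpaces] Sect. D's input; (1.9) = `DivSmall` is its output), and that half follows from the first two (19)-members BEFORE (128) (✓`Prop7PlaqChartPointOfOrders01` ∘
# ★px18 ✓`Prop7Size19Orders01.orders01_of_eq111_T3`) — so the bridge `hSplit′ ⟹ hSplit127` (★px5 «SPLIT127-BRIDGE», v3 with `hplaq′`) no longer needs (136)+(140), and the `h128Δ` inhabitant chain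
# ✓p680716∕✓p681225 becomes ACYCLIC, as in print.  Cell `ym3-torus` (HUMAN RULING D-0037, rung R3 — YM₃ on T³, NOT d = 4, NOT Clay; YM gap NOT proved), width seat `ym3-torus-px16` (gen 3).
# THEOREMS ONLY (0 `def`, 0 `sorry`); `--supports stmt-QuantumFields-19200 --as helper`, count-neutral; nothing of the stub∕crux∕gap claimed.
# References: T. Bałaban, CMP **98** (1985) 17–51 [Balaban1985Averaging] ((11) p.19, (89) p.31, (97) p.32); CMP **99** (1985) 75–102 [Balaban1985RegularSpaces] ((1.7)+(1.9) p.77, Sect. D pp.89–95,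
# Prop. 7 p.98); CMP **102** (1985) 277–309 [Balaban1985Variational] ((44) p.285, (82)–(83) p.290, (124)–(126) p.296); CMP **109** (1987) 249–301 [Balaban1987RG1] ((0.11) p.253).
-/

set_option autoImplicit false

noncomputable section

open scoped BigOperators Matrix.Norms.L2Operator Matrix Topology RightActions
open Filter

namespace Summit.QuantumFields.YangMills.Theorems.Prop7SliceChainOfPlaqSmall

open NormedSpace Metric Set
open Literature.MathematicalPhysics.QuantumFieldTheory.Balaban1983to89
open Literature.MathematicalPhysics.QuantumFieldTheory.Balaban1983to89.T3ContinuumYM3Torus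
open Literature.MathematicalPhysics.QuantumFieldTheory.Balaban1983to89.T3SectALandauChart (bgUnits eta eta_pos)
open Literature.MathematicalPhysics.QuantumFieldTheory.Balaban1983to89.T3PrintedRegularMinimiser (RegPr)
open T3RegularMinimiser (regThreshold)
open T3LevelShift (siteShift)
open T3PrintedRegularOrbits (sites_eq)
open B15DeterminingSets (embIter)
open B7Prop1Explicit (expUnit val_expUnit)
open B10Eq27TorusAxialLog (unitsField toUField)
open MatrixLog (mlog exp_mlog analyticAt_mlog)
open Literature.Analysis.Calculus.ExpDifferential (ad gSer dexp hasFDerivAt_exp_dexp)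
open Summit.QuantumFields.YangMills.Theorems.Prop8Chart (expCfg coe_expCfg emlIterU)
open Summit.QuantumFields.YangMills.Theorems.Prop7SymAvgGL (descendToGL logChartSym QSym descendToGL_eq_fieldShift_emlIterU)
open Summit.QuantumFields.YangMills.Theorems.Prop7SymAvgRelativeBound (analyticAt_relIter_of_plaqSmall budget_T3 perturbedField_eq)
open Summit.QuantumFields.YangMills.Theorems.Prop7QSymGaugeCovariance (QSym_gaugeDir)
open Summit.QuantumFields.YangMills.Theorems.Prop7SymAvgTwGaugeDir (hasFDerivAt_logChartSym)
open Summit.QuantumFields.YangMills.Theorems.Prop7SymAvgTwSym (frameTwS dbarTwS logChartTwS)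
open Summit.QuantumFields.YangMills.Theorems.Prop7SymAvgTwSymBridge (dbarTwS_eq_conj)
open Summit.QuantumFields.YangMills.Theorems.Prop7SymFrameBound (analyticAt_frameTwS_of_regPr)
open Summit.QuantumFields.YangMills.Theorems.Prop7CmapTwSymInputs (norm_dbarTwS_sub_one_le_of_mem_ball)
open Summit.QuantumFields.YangMills.Theorems.Prop7ChartVelocityDexp (hasFDerivAt_rel_rebase rel_rebase_fderiv_apply)
open Summit.QuantumFields.YangMills.Theorems.Prop7TwistedSliceTangent
open Summit.QuantumFields.YangMills.Theorems.Prop7TwistedSliceGaugeCorrection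
open Summit.QuantumFields.YangMills.Theorems.Prop7TwistedSliceGaugeCorrectionAny (comparisonSite_injective extend_comparisonSite_apply extend_comparisonSite_skew_traceless)
open Summit.QuantumFields.YangMills.Theorems.Prop7SymAvgTwSymSlice (embIter_injective)

variable (F : T3Family) {n K : ℕ} (h : n ≤ K)

/-! ## §1 The relative average at a PLAQUETTE-regular background (twins of ✓`Prop7SymAvgRelDiffT3`) -/

/-- ★ **THE RELATIVE DESCENDED PERTURBATION IS ANALYTIC AT `A = 0` AT A PRINTED-REGULAR BACKGROUND**, bond by bond: `A ↦ D̄_GL(e^{A}U₀)(c)·D̄_GL(U₀)(c)⁻¹` is analytic at `0` for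
`RegPr F n K ε₀ U₀`, `10⁷L³ε₀ ≤ 1` (★w4's `analyticAt_relIter_of_plaqSmall` at the rescaled exponent `(iη)⁻¹A`, `η = L^{−(K−n)}`, through `descendToGL = fieldShift ∘ emlIterU`).
[cite: Balaban1987RG1, (0.4) p.253, (0.21) p.256; Balaban1985Averaging, Prop. 4 (134)–(135) p.38] -/
theorem analyticAt_rel_zero_of_plaqSmall {ε₀ : ℝ} (hε₀ : 0 < ε₀) (hε : 10 ^ 7 * (F.L : ℝ) ^ 3 * ε₀ ≤ 1)
    (U₀ : GaugeField (F.P K) 0 (Matrix.specialUnitaryGroup (Fin 2) ℂ)) (hplaq : PlaqSmall (regThreshold F n K ε₀) U₀) (c : PBond (F.P n) 0) :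
    AnalyticAt ℂ (fun A : PBond (F.P K) 0 → Matrix (Fin 2) (Fin 2) ℂ =>
      ((descendToGL F n K h (fun b => expUnit (A b) * bgUnits F K U₀ b) c : (Matrix (Fin 2) (Fin 2) ℂ)ˣ) : Matrix (Fin 2) (Fin 2) ℂ)
        * (((descendToGL F n K h (bgUnits F K U₀) c)⁻¹ : (Matrix (Fin 2) (Fin 2) ℂ)ˣ) : Matrix (Fin 2) (Fin 2) ℂ)) 0 := by
  -- letters (as in ★w4's `inputs_CmapSym`)
  have hd : (F.P K).d = 3 := T3Family.P_d F K
  have hLL : ((F.P K).L : ℝ) = F.L := rfl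
  have hL3 : 3 ≤ F.L := by obtain ⟨a, ha⟩ := F.hL.1; have := F.hL.2; omega
  have hL3r : (3 : ℝ) ≤ F.L := by exact_mod_cast hL3
  have hL0 : (0 : ℝ) < F.L := by linarith
  have hk1 : K - n + 1 ≤ (F.P K).m + (F.P K).K := by
    show K - n + 1 ≤ F.m + K; have := F.hm; omega
  set η : ℝ := ((F.L : ℝ)⁻¹) ^ (K - n) with hη
  have hη0 : 0 < η := by positivity
  have hηne : η ≠ 0 := hη0.ne'
  set r : ℝ := 1 / (10 ^ 6 * (F.L : ℝ) ^ 2) with hr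
  have hr0 : 0 ≤ r := by positivity
  have hrr : 10 ^ 6 * (F.L : ℝ) ^ 2 * r ≤ 1 := by rw [hr, mul_one_div_cancel (by positivity)]
  set a₀ : ℝ := regThreshold F n K ε₀ with ha₀
  have ha₀0 : 0 < a₀ := by rw [ha₀]; unfold regThreshold; positivity
  have hXa : (F.L : ℝ) ^ (K - n) * ((F.L : ℝ) ^ (K - n) * a₀) = ε₀ := by
    have hX2 : (F.L : ℝ) ^ (K - n) * (F.L : ℝ) ^ (K - n) = (F.L : ℝ) ^ (2 * (K - n)) := by rw [← pow_add, two_mul]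
    have ha : a₀ = ε₀ * ((F.L : ℝ) ^ (2 * (K - n)))⁻¹ := by rw [ha₀]; unfold regThreshold; rw [inv_pow]
    rw [← mul_assoc, hX2, ha, mul_comm ε₀, ← mul_assoc, mul_inv_cancel₀ (pow_ne_zero _ hL0.ne'), one_mul]
  have hU : PlaqSmall a₀ U₀ := hplaq
  obtain ⟨ht1, hbudget, -, -⟩ := budget_T3 F (K - n) hε₀ hε hr0 hrr ha₀0.le hXa
  -- the rescaling `A ↦ (iη)⁻¹A` and the top bond
  set σ : (PBond (F.P K) 0 → Matrix (Fin 2) (Fin 2) ℂ) →L[ℂ] (PBond (F.P K) 0 → Matrix (Fin 2) (Fin 2) ℂ) :=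
    (Complex.I * (η : ℂ))⁻¹ • ContinuousLinearMap.id ℂ (PBond (F.P K) 0 → Matrix (Fin 2) (Fin 2) ℂ) with hσ
  have hσ_apply : ∀ A : PBond (F.P K) 0 → Matrix (Fin 2) (Fin 2) ℂ, σ A = fun b => (Complex.I * (η : ℂ))⁻¹ • A b := fun A => by
    rw [hσ]; rfl
  have hσ0 : σ 0 = 0 := map_zero σ
  set e : PBond (F.P K) (K - n) :=
    T3LevelShift.bondShift (F.sitesPerDir_eq (m := F.m) (K := n) (j := 0) (m' := F.m) (K' := K) (j' := K - n) (by omega)) c with he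
  -- reads at `A₀ = 0`: `‖η·σ(0)(b)‖ = 0 ≤ ηr`
  have hreads : ∀ b, ‖(η : ℂ) • σ 0 b‖ ≤ η * r := fun b => by
    rw [hσ0, Pi.zero_apply, smul_zero, norm_zero]; positivity
  -- ★w4's analyticity at the rescaled exponent
  have h1 := analyticAt_relIter_of_plaqSmall hk1 U₀ ha₀0 hU η (σ 0) ht1 hreads (by rw [hd, hLL]; exact hbudget) e
  have h2 : AnalyticAt ℂ (fun A : PBond (F.P K) 0 → Matrix (Fin 2) (Fin 2) ℂ =>
      ((emlIterU (K - n) (fun b => expCfg η (σ A) b * unitsField (toUField U₀) b) e : (Matrix (Fin 2) (Fin 2) ℂ)ˣ) : Matrix (Fin 2) (Fin 2) ℂ) *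
        (((emlIterU (K - n) (unitsField (toUField U₀)) e)⁻¹ : (Matrix (Fin 2) (Fin 2) ℂ)ˣ) : Matrix (Fin 2) (Fin 2) ℂ)) 0 :=
    AnalyticAt.comp_of_eq h1 (σ.analyticAt 0) rfl
  -- the junction with ★w1's letters
  have hfun : (fun A : PBond (F.P K) 0 → Matrix (Fin 2) (Fin 2) ℂ =>
      ((descendToGL F n K h (fun b => expUnit (A b) * bgUnits F K U₀ b) c : (Matrix (Fin 2) (Fin 2) ℂ)ˣ) : Matrix (Fin 2) (Fin 2) ℂ)
        * (((descendToGL F n K h (bgUnits F K U₀) c)⁻¹ : (Matrix (Fin 2) (Fin 2) ℂ)ˣ) : Matrix (Fin 2) (Fin 2) ℂ))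
      = fun A => ((emlIterU (K - n) (fun b => expCfg η (σ A) b * unitsField (toUField U₀) b) e : (Matrix (Fin 2) (Fin 2) ℂ)ˣ) : Matrix (Fin 2) (Fin 2) ℂ) *
        (((emlIterU (K - n) (unitsField (toUField U₀)) e)⁻¹ : (Matrix (Fin 2) (Fin 2) ℂ)ˣ) : Matrix (Fin 2) (Fin 2) ℂ) := by
    funext A
    rw [descendToGL_eq_fieldShift_emlIterU, descendToGL_eq_fieldShift_emlIterU, perturbedField_eq F K hηne U₀ A, hσ_apply]
    rfl
  rw [hfun]
  exact h2

/-- ★ **`hG` OF THE Σ-TWIST BRIDGES, DISCHARGED**: at a printed-regular background, `G : A ↦ (c ↦ D̄_GL(e^{A}U₀)(c)·D̄_GL(U₀)(c)⁻¹)` satisfies `HasFDerivAt G (fderiv ℂ G 0) 0`.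
[cite: Balaban1987RG1, (0.4) p.253; Balaban1985Variational, (44) p.285] -/
theorem hasFDerivAt_rel_of_plaqSmall {ε₀ : ℝ} (hε₀ : 0 < ε₀) (hε : 10 ^ 7 * (F.L : ℝ) ^ 3 * ε₀ ≤ 1)
    (U₀ : GaugeField (F.P K) 0 (Matrix.specialUnitaryGroup (Fin 2) ℂ)) (hplaq : PlaqSmall (regThreshold F n K ε₀) U₀) :
    HasFDerivAt (fun A : PBond (F.P K) 0 → Matrix (Fin 2) (Fin 2) ℂ => fun c : PBond (F.P n) 0 =>
        ((descendToGL F n K h (fun b => expUnit (A b) * bgUnits F K U₀ b) c : (Matrix (Fin 2) (Fin 2) ℂ)ˣ) : Matrix (Fin 2) (Fin 2) ℂ)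
          * (((descendToGL F n K h (bgUnits F K U₀) c)⁻¹ : (Matrix (Fin 2) (Fin 2) ℂ)ˣ) : Matrix (Fin 2) (Fin 2) ℂ))
      (fderiv ℂ (fun A : PBond (F.P K) 0 → Matrix (Fin 2) (Fin 2) ℂ => fun c : PBond (F.P n) 0 =>
        ((descendToGL F n K h (fun b => expUnit (A b) * bgUnits F K U₀ b) c : (Matrix (Fin 2) (Fin 2) ℂ)ˣ) : Matrix (Fin 2) (Fin 2) ℂ)
          * (((descendToGL F n K h (bgUnits F K U₀) c)⁻¹ : (Matrix (Fin 2) (Fin 2) ℂ)ˣ) : Matrix (Fin 2) (Fin 2) ℂ)) 0) 0 := by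
  have hdiff : DifferentiableAt ℂ (fun A : PBond (F.P K) 0 → Matrix (Fin 2) (Fin 2) ℂ => fun c : PBond (F.P n) 0 =>
      ((descendToGL F n K h (fun b => expUnit (A b) * bgUnits F K U₀ b) c : (Matrix (Fin 2) (Fin 2) ℂ)ˣ) : Matrix (Fin 2) (Fin 2) ℂ)
        * (((descendToGL F n K h (bgUnits F K U₀) c)⁻¹ : (Matrix (Fin 2) (Fin 2) ℂ)ˣ) : Matrix (Fin 2) (Fin 2) ℂ)) 0 :=
    differentiableAt_pi.2 fun c => (analyticAt_rel_zero_of_plaqSmall F h hε₀ hε U₀ hplaq c).differentiableAt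
  exact hdiff.hasFDerivAt

/-- ★ **`hS` DISCHARGED**: `logChartSym U₀` is differentiable at `0` at a printed-regular background (`Prop7SymAvgTwGaugeDir.hasFDerivAt_logChartSym` ∘ `hasFDerivAt_rel_of_plaqSmall`).
[cite: Balaban1985Variational, (44) p.285; Balaban1987RG1, (0.4) p.253] -/
theorem differentiableAt_logChartSym_zero_of_plaqSmall {ε₀ : ℝ} (hε₀ : 0 < ε₀) (hε : 10 ^ 7 * (F.L : ℝ) ^ 3 * ε₀ ≤ 1)
    (U₀ : GaugeField (F.P K) 0 (Matrix.specialUnitaryGroup (Fin 2) ℂ)) (hplaq : PlaqSmall (regThreshold F n K ε₀) U₀) :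
    DifferentiableAt ℂ (logChartSym F n K h U₀) 0 :=
  (hasFDerivAt_logChartSym F h U₀ (hasFDerivAt_rel_of_plaqSmall F h hε₀ hε U₀ hplaq)).differentiableAt

/-- ★★ **`QSym U₀ (D_{U₀}λ) = D_{Ū₀}(λ↓)` UNCONDITIONALLY AT PRINTED-REGULAR BACKGROUNDS** — the pinned covariance of the (AVG-SYM) core (`Prop7QSymGaugeCovariance.QSym_gaugeDir`) with its
differentiability hypothesis discharged from `RegPr F n K ε₀ U₀`, `10⁷L³ε₀ ≤ 1`. [cite: Balaban1985Averaging, (11) p.19, p.28; Balaban1985RegularSpaces, p.80; Balaban1987RG1, (0.11) p.253] -/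
theorem QSym_gaugeDir_of_plaqSmall {ε₀ : ℝ} (hε₀ : 0 < ε₀) (hε : 10 ^ 7 * (F.L : ℝ) ^ 3 * ε₀ ≤ 1)
    (U₀ : GaugeField (F.P K) 0 (Matrix.specialUnitaryGroup (Fin 2) ℂ)) (hplaq : PlaqSmall (regThreshold F n K ε₀) U₀)
    (lam : Site (F.P K) 0 → Matrix (Fin 2) (Fin 2) ℂ) :
    QSym F n K h U₀ (fun b : PBond (F.P K) 0 =>
        lam b.src - ((bgUnits F K U₀ b : (Matrix (Fin 2) (Fin 2) ℂ)ˣ) : Matrix (Fin 2) (Fin 2) ℂ) * lam b.tgt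
          * (((bgUnits F K U₀ b)⁻¹ : (Matrix (Fin 2) (Fin 2) ℂ)ˣ) : Matrix (Fin 2) (Fin 2) ℂ))
      = fun c : PBond (F.P n) 0 =>
        lam (embIter (K - n) (siteShift (sites_eq F n K h) c.src))
          - ((descendToGL F n K h (bgUnits F K U₀) c : (Matrix (Fin 2) (Fin 2) ℂ)ˣ) : Matrix (Fin 2) (Fin 2) ℂ) * lam (embIter (K - n) (siteShift (sites_eq F n K h) c.tgt))
            * (((descendToGL F n K h (bgUnits F K U₀) c)⁻¹ : (Matrix (Fin 2) (Fin 2) ℂ)ˣ) : Matrix (Fin 2) (Fin 2) ℂ) :=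
  QSym_gaugeDir (h := h) U₀ (differentiableAt_logChartSym_zero_of_plaqSmall F h hε₀ hε U₀ hplaq) lam

/-! ## §2 T2 at a plaquette-regular chart point (twin of ✓`fderiv_logChartTwS_apply_eq_zero_iff_of_regPr`) -/

/-- ★★★ **THE TANGENT SPACE OF THE TWISTED SLICE `{A : logChartTwS U₀ A = B}` AT THE CHART POINT `A₁`, IN THE LETTERS OF THE RELATIVE AVERAGE AT `U′ = e^{A₁}U₀`** — all inputs discharged at
printed-regular backgrounds (`U₀ ∈ 𝔘_k(ε₀)`, `U′ ∈ 𝔘_k(ε₀′)`, `10¹²L³ε₀ ≤ 1`, `10⁷L³ε₀′ ≤ 1`, `10⁹L²e ≤ 1`, `‖A₁‖ < e·η`): for every direction `α`,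
`D(logChartTwS U₀)(A₁) α = 0 ⟺ ∀ c, G′(U′)(Mα)(c)·G₁(c) = λ_α(c₋)·G₁(c) − G₁(c)·Ū₀(c)·λ_α(c₊)·Ū₀(c)⁻¹`, where `G′(U′) := fderiv` of the `U′`-based relative average at `0` (= `QSym(U′)` through
✓`hasFDerivAt_logChartSym`), `Mα = (g(ad(−A₁ b))(α b))_b` the velocity map, `G₁(c) = D̄(U′)(c)·D̄(U₀)(c)⁻¹`, and `λ_α(y) := (D w_·(y))(A₁)[α]·w_{A₁}(y)⁻¹` the right-trivialised response of the symmetric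
accumulated frames.  Reading: a chart direction is tangent to the twisted slice iff the straight linearised average of its velocity AT `U′` is the coarse infinitesimal gauge motion of `D̄(U′)` by the
frame response — the junction where (LIN-1) of the `hXtw‴`(iii) transport must supply «frame response to gauge directions». [cite: Balaban1985Averaging, (11) p.19, (89) p.31, (97) p.32; Balaban1985Variational, (44) p.285, (47)-(49) p.285, (82)-(83) p.290] -/
theorem fderiv_logChartTwS_apply_eq_zero_iff_of_plaqSmall {ε₀ ε₀' e : ℝ} (hε₀ : 0 < ε₀) (he : 0 < e) (hWe : 10 ^ 9 * (F.L : ℝ) ^ 2 * e ≤ 1) (hWε : 10 ^ 12 * (F.L : ℝ) ^ 3 * ε₀ ≤ 1)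
    (hε₀' : 0 < ε₀') (hε' : 10 ^ 7 * (F.L : ℝ) ^ 3 * ε₀' ≤ 1)
    (U₀ U' : GaugeField (F.P K) 0 (Matrix.specialUnitaryGroup (Fin 2) ℂ)) (hreg : RegPr F n K ε₀ U₀) (hplaq' : PlaqSmall (regThreshold F n K ε₀') U')
    (A₁ : PBond (F.P K) 0 → Matrix (Fin 2) (Fin 2) ℂ) (hA₁ : ‖A₁‖ < e * eta F n K)
    (hU' : ∀ b, ((U' b : Matrix.specialUnitaryGroup (Fin 2) ℂ) : Matrix (Fin 2) (Fin 2) ℂ) = exp (A₁ b) * ((U₀ b : Matrix.specialUnitaryGroup (Fin 2) ℂ) : Matrix (Fin 2) (Fin 2) ℂ))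
    (α : PBond (F.P K) 0 → Matrix (Fin 2) (Fin 2) ℂ) :
    fderiv ℂ (logChartTwS F n K h U₀) A₁ α = 0 ↔
      ∀ c : PBond (F.P n) 0,
        (fderiv ℂ (fun A : PBond (F.P K) 0 → Matrix (Fin 2) (Fin 2) ℂ => fun c : PBond (F.P n) 0 =>
            ((descendToGL F n K h (fun b => expUnit (A b) * bgUnits F K U' b) c : (Matrix (Fin 2) (Fin 2) ℂ)ˣ) : Matrix (Fin 2) (Fin 2) ℂ) *
              (((descendToGL F n K h (bgUnits F K U') c)⁻¹ : (Matrix (Fin 2) (Fin 2) ℂ)ˣ) : Matrix (Fin 2) (Fin 2) ℂ)) 0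
            (fun b => gSer ℂ (ad ℂ (-A₁ b)) (α b)) c) *
          (((descendToGL F n K h (bgUnits F K U') c : (Matrix (Fin 2) (Fin 2) ℂ)ˣ) : Matrix (Fin 2) (Fin 2) ℂ) *
            (((descendToGL F n K h (bgUnits F K U₀) c)⁻¹ : (Matrix (Fin 2) (Fin 2) ℂ)ˣ) : Matrix (Fin 2) (Fin 2) ℂ))
        = fderiv ℂ (fun A : PBond (F.P K) 0 → Matrix (Fin 2) (Fin 2) ℂ => ((frameTwS F n K h U₀ A c.src : (Matrix (Fin 2) (Fin 2) ℂ)ˣ) : Matrix (Fin 2) (Fin 2) ℂ)) A₁ α *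
            (((frameTwS F n K h U₀ A₁ c.src)⁻¹ : (Matrix (Fin 2) (Fin 2) ℂ)ˣ) : Matrix (Fin 2) (Fin 2) ℂ) *
            (((descendToGL F n K h (bgUnits F K U') c : (Matrix (Fin 2) (Fin 2) ℂ)ˣ) : Matrix (Fin 2) (Fin 2) ℂ) *
              (((descendToGL F n K h (bgUnits F K U₀) c)⁻¹ : (Matrix (Fin 2) (Fin 2) ℂ)ˣ) : Matrix (Fin 2) (Fin 2) ℂ))
          - (((descendToGL F n K h (bgUnits F K U') c : (Matrix (Fin 2) (Fin 2) ℂ)ˣ) : Matrix (Fin 2) (Fin 2) ℂ) *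
              (((descendToGL F n K h (bgUnits F K U₀) c)⁻¹ : (Matrix (Fin 2) (Fin 2) ℂ)ˣ) : Matrix (Fin 2) (Fin 2) ℂ)) *
            (((descendToGL F n K h (bgUnits F K U₀) c : (Matrix (Fin 2) (Fin 2) ℂ)ˣ) : Matrix (Fin 2) (Fin 2) ℂ) *
              (fderiv ℂ (fun A : PBond (F.P K) 0 → Matrix (Fin 2) (Fin 2) ℂ => ((frameTwS F n K h U₀ A c.tgt : (Matrix (Fin 2) (Fin 2) ℂ)ˣ) : Matrix (Fin 2) (Fin 2) ℂ)) A₁ α *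
                (((frameTwS F n K h U₀ A₁ c.tgt)⁻¹ : (Matrix (Fin 2) (Fin 2) ℂ)ˣ) : Matrix (Fin 2) (Fin 2) ℂ)) *
              (((descendToGL F n K h (bgUnits F K U₀) c)⁻¹ : (Matrix (Fin 2) (Fin 2) ℂ)ˣ) : Matrix (Fin 2) (Fin 2) ℂ)) := by
  -- bondwise size of `A₁`
  have hA₁b : ∀ b, ‖A₁ b‖ ≤ e * eta F n K := fun b => (norm_le_pi_norm A₁ b).trans hA₁.le
  -- the configuration `e^{A₁}U₀♭ = U′♭`
  have hcfg : (fun b => expUnit (A₁ b) * bgUnits F K U₀ b) = bgUnits F K U' := by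
    funext b
    apply Units.ext
    rw [Units.val_mul, val_expUnit]
    show exp (A₁ b) * ((U₀ b : Matrix.specialUnitaryGroup (Fin 2) ℂ) : Matrix (Fin 2) (Fin 2) ℂ) = ((U' b : Matrix.specialUnitaryGroup (Fin 2) ℂ) : Matrix (Fin 2) (Fin 2) ℂ)
    rw [hU' b]
  -- (T1) the `U₀`-based relative average differentiated at `A₁` through `G′(U′)`; the frames at `A₁`; the window
  have hL := hasFDerivAt_rel_rebase F h U₀ U' A₁ hU' (hasFDerivAt_rel_of_plaqSmall F h hε₀' hε' U' hplaq')
  have hr := fun y => hasFDerivAt_frameTwS_at_of_regPr F h hε₀ he hWe hWε U₀ hreg hA₁b y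
  have hball := norm_dbarTwS_sub_one_lt_one_of_regPr F h hε₀ he hWe hWε U₀ hreg hA₁
  rw [fderiv_logChartTwS_apply_eq_zero_iff F h U₀ A₁ hL hr hball α]
  refine forall_congr' fun c => ?_
  rw [rel_rebase_fderiv_apply, hcfg]

/-! ## §3 T3 at a plaquette-regular chart point -/

/-- ★★★ **SLICE-TANGENT ⟹ FIBRE-TANGENT UP TO A GAUGE DIRECTION AT `U′` (exact, no estimate).**  In the setting of `fderiv_logChartTwS_apply_eq_zero_iff_of_regPr`: if `α` is tangent to the twisted
slice at `A₁` (`D(logChartTwS U₀)(A₁) α = 0`), then for the fine gauge parameter `N` extending the frame response `λ_α` from the comparison sites (`N(x̂_y) = λ_α(y)`, zero elsewhere) the velocity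
`Mα` minus the gauge direction `G_{U′}(N) = (b ↦ N(b₋) − U′(b)N(b₊)U′(b)⁻¹)` lies in `ker QSym(U′)`: `QSym U′ (Mα − G_{U′}N) = 0`.  Proof: T2 §5 gives `QSym U′ (Mα)(c) = λ_α(ĉ₋)… ` as the coarse gauge direction of
`λ_α` at `D̄(U′)`, and ✓`QSym_gaugeDir_of_regPr` gives the same for `QSym U′ (G_{U′}N)`.  This is the exact half of the `hsplit` transport: `M(S) ⊆ ker QSym(U′) + 𝒢_{U′}`.
[cite: Balaban1985Averaging, (11) p.19, (87) p.31, (97) p.32; Balaban1985Variational, (44)-(49) p.285, (82)-(83) p.290] -/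
theorem exists_gaugeDir_QSym_velocity_sub_eq_zero_of_slice_tangent_of_plaqSmall {ε₀ ε₀' e : ℝ} (hε₀ : 0 < ε₀) (he : 0 < e) (hWe : 10 ^ 9 * (F.L : ℝ) ^ 2 * e ≤ 1) (hWε : 10 ^ 12 * (F.L : ℝ) ^ 3 * ε₀ ≤ 1)
    (hε₀' : 0 < ε₀') (hε' : 10 ^ 7 * (F.L : ℝ) ^ 3 * ε₀' ≤ 1)
    (U₀ U' : GaugeField (F.P K) 0 (Matrix.specialUnitaryGroup (Fin 2) ℂ)) (hreg : RegPr F n K ε₀ U₀) (hplaq' : PlaqSmall (regThreshold F n K ε₀') U')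
    (A₁ : PBond (F.P K) 0 → Matrix (Fin 2) (Fin 2) ℂ) (hA₁ : ‖A₁‖ < e * eta F n K)
    (hU' : ∀ b, ((U' b : Matrix.specialUnitaryGroup (Fin 2) ℂ) : Matrix (Fin 2) (Fin 2) ℂ) = exp (A₁ b) * ((U₀ b : Matrix.specialUnitaryGroup (Fin 2) ℂ) : Matrix (Fin 2) (Fin 2) ℂ))
    (α : PBond (F.P K) 0 → Matrix (Fin 2) (Fin 2) ℂ) (hα : fderiv ℂ (logChartTwS F n K h U₀) A₁ α = 0) :
    ∃ N : Site (F.P K) 0 → Matrix (Fin 2) (Fin 2) ℂ,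
      (∀ y : Site (F.P n) 0, N (embIter (K - n) (siteShift (sites_eq F n K h) y))
          = fderiv ℂ (fun A : PBond (F.P K) 0 → Matrix (Fin 2) (Fin 2) ℂ => ((frameTwS F n K h U₀ A y : (Matrix (Fin 2) (Fin 2) ℂ)ˣ) : Matrix (Fin 2) (Fin 2) ℂ)) A₁ α *
              (((frameTwS F n K h U₀ A₁ y)⁻¹ : (Matrix (Fin 2) (Fin 2) ℂ)ˣ) : Matrix (Fin 2) (Fin 2) ℂ)) ∧
      QSym F n K h U' ((fun b : PBond (F.P K) 0 => gSer ℂ (ad ℂ (-A₁ b)) (α b))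
          - fun b : PBond (F.P K) 0 => N b.src - ((bgUnits F K U' b : (Matrix (Fin 2) (Fin 2) ℂ)ˣ) : Matrix (Fin 2) (Fin 2) ℂ) * N b.tgt *
              (((bgUnits F K U' b)⁻¹ : (Matrix (Fin 2) (Fin 2) ℂ)ˣ) : Matrix (Fin 2) (Fin 2) ℂ)) = 0 := by
  -- T2 §5 at `α`, then name the frame response `λ_α`
  have hT2 := (fderiv_logChartTwS_apply_eq_zero_iff_of_plaqSmall F h hε₀ he hWe hWε hε₀' hε' U₀ U' hreg hplaq' A₁ hA₁ hU' α).1 hα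
  set lam : Site (F.P n) 0 → Matrix (Fin 2) (Fin 2) ℂ := fun y =>
    fderiv ℂ (fun A : PBond (F.P K) 0 → Matrix (Fin 2) (Fin 2) ℂ => ((frameTwS F n K h U₀ A y : (Matrix (Fin 2) (Fin 2) ℂ)ˣ) : Matrix (Fin 2) (Fin 2) ℂ)) A₁ α *
      (((frameTwS F n K h U₀ A₁ y)⁻¹ : (Matrix (Fin 2) (Fin 2) ℂ)ˣ) : Matrix (Fin 2) (Fin 2) ℂ) with hlam
  -- the extension `N` of `λ_α` from the comparison sites (distinct by `embIter_injective`)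
  have hKn : K - n ≤ (F.P K).m + (F.P K).K := by
    show K - n ≤ F.m + K
    have := F.hm
    omega
  have hinj : Function.Injective fun y : Site (F.P n) 0 => embIter (K - n) (siteShift (sites_eq F n K h) y) :=
    fun a b hab => (siteShift (sites_eq F n K h)).injective (embIter_injective (K - n) hKn hab)
  refine ⟨Function.extend (fun y : Site (F.P n) 0 => embIter (K - n) (siteShift (sites_eq F n K h) y)) lam 0, fun y => hinj.extend_apply lam 0 y, ?_⟩
  -- `QSym U′` is the derivative of the `U′`-based relative average
  have hG := hasFDerivAt_rel_of_plaqSmall F h hε₀' hε' U' hplaq'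
  have hQ : QSym F n K h U' = fderiv ℂ (fun A : PBond (F.P K) 0 → Matrix (Fin 2) (Fin 2) ℂ => fun c : PBond (F.P n) 0 =>
        ((descendToGL F n K h (fun b => expUnit (A b) * bgUnits F K U' b) c : (Matrix (Fin 2) (Fin 2) ℂ)ˣ) : Matrix (Fin 2) (Fin 2) ℂ) *
          (((descendToGL F n K h (bgUnits F K U') c)⁻¹ : (Matrix (Fin 2) (Fin 2) ℂ)ˣ) : Matrix (Fin 2) (Fin 2) ℂ)) 0 :=
    (hasFDerivAt_logChartSym F h U' hG).fderiv
  -- the gauge row at `U′`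
  have hgauge := QSym_gaugeDir_of_plaqSmall F h hε₀' hε' U' hplaq' (Function.extend (fun y : Site (F.P n) 0 => embIter (K - n) (siteShift (sites_eq F n K h) y)) lam 0)
  rw [map_sub, hgauge, hQ]
  funext c
  have h1 : Function.extend (fun y : Site (F.P n) 0 => embIter (K - n) (siteShift (sites_eq F n K h) y)) lam 0
      (embIter (K - n) (siteShift (sites_eq F n K h) c.src)) = lam c.src := hinj.extend_apply lam 0 c.src
  have h2 : Function.extend (fun y : Site (F.P n) 0 => embIter (K - n) (siteShift (sites_eq F n K h) y)) lam 0
      (embIter (K - n) (siteShift (sites_eq F n K h) c.tgt)) = lam c.tgt := hinj.extend_apply lam 0 c.tgt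
  rw [Pi.sub_apply, Pi.zero_apply]
  erw [h1, h2]
  -- unit letters at `c` and T2's identity, solved for the straight average of the velocity
  set D' : (Matrix (Fin 2) (Fin 2) ℂ)ˣ := descendToGL F n K h (bgUnits F K U') c with hD'
  set P₀ : (Matrix (Fin 2) (Fin 2) ℂ)ˣ := descendToGL F n K h (bgUnits F K U₀) c with hP₀
  have hc := hT2 c
  have hX : fderiv ℂ (fun A : PBond (F.P K) 0 → Matrix (Fin 2) (Fin 2) ℂ => fun c : PBond (F.P n) 0 =>
        ((descendToGL F n K h (fun b => expUnit (A b) * bgUnits F K U' b) c : (Matrix (Fin 2) (Fin 2) ℂ)ˣ) : Matrix (Fin 2) (Fin 2) ℂ) *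
          (((descendToGL F n K h (bgUnits F K U') c)⁻¹ : (Matrix (Fin 2) (Fin 2) ℂ)ˣ) : Matrix (Fin 2) (Fin 2) ℂ)) 0 (fun b => gSer ℂ (ad ℂ (-A₁ b)) (α b)) c
      = lam c.src - (D' : Matrix (Fin 2) (Fin 2) ℂ) * lam c.tgt * ((D'⁻¹ : (Matrix (Fin 2) (Fin 2) ℂ)ˣ) : Matrix (Fin 2) (Fin 2) ℂ) := by
    have hone : ((D' : Matrix (Fin 2) (Fin 2) ℂ) * ((P₀⁻¹ : (Matrix (Fin 2) (Fin 2) ℂ)ˣ) : Matrix (Fin 2) (Fin 2) ℂ)) *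
        ((P₀ : Matrix (Fin 2) (Fin 2) ℂ) * ((D'⁻¹ : (Matrix (Fin 2) (Fin 2) ℂ)ˣ) : Matrix (Fin 2) (Fin 2) ℂ)) = 1 := by
      simp only [mul_assoc, Units.inv_mul_cancel_left, Units.mul_inv]
    calc fderiv ℂ (fun A : PBond (F.P K) 0 → Matrix (Fin 2) (Fin 2) ℂ => fun c : PBond (F.P n) 0 =>
            ((descendToGL F n K h (fun b => expUnit (A b) * bgUnits F K U' b) c : (Matrix (Fin 2) (Fin 2) ℂ)ˣ) : Matrix (Fin 2) (Fin 2) ℂ) *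
              (((descendToGL F n K h (bgUnits F K U') c)⁻¹ : (Matrix (Fin 2) (Fin 2) ℂ)ˣ) : Matrix (Fin 2) (Fin 2) ℂ)) 0 (fun b => gSer ℂ (ad ℂ (-A₁ b)) (α b)) c
        = fderiv ℂ (fun A : PBond (F.P K) 0 → Matrix (Fin 2) (Fin 2) ℂ => fun c : PBond (F.P n) 0 =>
            ((descendToGL F n K h (fun b => expUnit (A b) * bgUnits F K U' b) c : (Matrix (Fin 2) (Fin 2) ℂ)ˣ) : Matrix (Fin 2) (Fin 2) ℂ) *
              (((descendToGL F n K h (bgUnits F K U') c)⁻¹ : (Matrix (Fin 2) (Fin 2) ℂ)ˣ) : Matrix (Fin 2) (Fin 2) ℂ)) 0 (fun b => gSer ℂ (ad ℂ (-A₁ b)) (α b)) c *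
            (((D' : Matrix (Fin 2) (Fin 2) ℂ) * ((P₀⁻¹ : (Matrix (Fin 2) (Fin 2) ℂ)ˣ) : Matrix (Fin 2) (Fin 2) ℂ)) *
              ((P₀ : Matrix (Fin 2) (Fin 2) ℂ) * ((D'⁻¹ : (Matrix (Fin 2) (Fin 2) ℂ)ˣ) : Matrix (Fin 2) (Fin 2) ℂ))) := by rw [hone, mul_one]
      _ = (lam c.src * ((D' : Matrix (Fin 2) (Fin 2) ℂ) * ((P₀⁻¹ : (Matrix (Fin 2) (Fin 2) ℂ)ˣ) : Matrix (Fin 2) (Fin 2) ℂ))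
            - ((D' : Matrix (Fin 2) (Fin 2) ℂ) * ((P₀⁻¹ : (Matrix (Fin 2) (Fin 2) ℂ)ˣ) : Matrix (Fin 2) (Fin 2) ℂ)) *
              ((P₀ : Matrix (Fin 2) (Fin 2) ℂ) * lam c.tgt * ((P₀⁻¹ : (Matrix (Fin 2) (Fin 2) ℂ)ˣ) : Matrix (Fin 2) (Fin 2) ℂ))) *
            ((P₀ : Matrix (Fin 2) (Fin 2) ℂ) * ((D'⁻¹ : (Matrix (Fin 2) (Fin 2) ℂ)ˣ) : Matrix (Fin 2) (Fin 2) ℂ)) := by rw [← mul_assoc, hc]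
      _ = lam c.src - (D' : Matrix (Fin 2) (Fin 2) ℂ) * lam c.tgt * ((D'⁻¹ : (Matrix (Fin 2) (Fin 2) ℂ)ˣ) : Matrix (Fin 2) (Fin 2) ℂ) := by
        rw [sub_mul]
        simp only [mul_assoc, Units.inv_mul_cancel_left, Units.mul_inv, mul_one]
  rw [hX, hD']
  exact sub_self _

/-! ## §4 (3′) at a plaquette-regular chart point -/

/-- ★★ **SLICE-TANGENT ⟹ FIBRE-TANGENT UP TO THE GAUGE DIRECTION OF ANY EXTENSION OF THE FRAME RESPONSE.**  In T3's setting (`U₀ ∈ 𝔘_k(ε₀)`, `U′ = e^{A₁}U₀ ∈ 𝔘_k(ε₀′)`, windows,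
`‖A₁‖ < e·η`, `D(logChartTwS U₀)(A₁) α = 0`): for EVERY fine gauge parameter `N′` with `N′(x̂_y) = λ_α(y)` at the comparison sites, `QSym U′ (Mα − G_{U′}N′) = 0`.
[cite: Balaban1985Averaging, (11) p.19, (87) p.31, (97) p.32; Balaban1985Variational, (44)-(49) p.285, (82)-(83) p.290] -/
theorem QSym_velocity_sub_gaugeDir_eq_zero_of_extends_of_plaqSmall {ε₀ ε₀' e : ℝ} (hε₀ : 0 < ε₀) (he : 0 < e) (hWe : 10 ^ 9 * (F.L : ℝ) ^ 2 * e ≤ 1) (hWε : 10 ^ 12 * (F.L : ℝ) ^ 3 * ε₀ ≤ 1)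
    (hε₀' : 0 < ε₀') (hε' : 10 ^ 7 * (F.L : ℝ) ^ 3 * ε₀' ≤ 1)
    (U₀ U' : GaugeField (F.P K) 0 (Matrix.specialUnitaryGroup (Fin 2) ℂ)) (hreg : RegPr F n K ε₀ U₀) (hplaq' : PlaqSmall (regThreshold F n K ε₀') U')
    (A₁ : PBond (F.P K) 0 → Matrix (Fin 2) (Fin 2) ℂ) (hA₁ : ‖A₁‖ < e * eta F n K)
    (hU' : ∀ b, ((U' b : Matrix.specialUnitaryGroup (Fin 2) ℂ) : Matrix (Fin 2) (Fin 2) ℂ) = exp (A₁ b) * ((U₀ b : Matrix.specialUnitaryGroup (Fin 2) ℂ) : Matrix (Fin 2) (Fin 2) ℂ))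
    (α : PBond (F.P K) 0 → Matrix (Fin 2) (Fin 2) ℂ) (hα : fderiv ℂ (logChartTwS F n K h U₀) A₁ α = 0)
    (N' : Site (F.P K) 0 → Matrix (Fin 2) (Fin 2) ℂ)
    (hN' : ∀ y : Site (F.P n) 0, N' (embIter (K - n) (siteShift (sites_eq F n K h) y))
          = fderiv ℂ (fun A : PBond (F.P K) 0 → Matrix (Fin 2) (Fin 2) ℂ => ((frameTwS F n K h U₀ A y : (Matrix (Fin 2) (Fin 2) ℂ)ˣ) : Matrix (Fin 2) (Fin 2) ℂ)) A₁ α *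
              (((frameTwS F n K h U₀ A₁ y)⁻¹ : (Matrix (Fin 2) (Fin 2) ℂ)ˣ) : Matrix (Fin 2) (Fin 2) ℂ)) :
    QSym F n K h U' ((fun b : PBond (F.P K) 0 => gSer ℂ (ad ℂ (-A₁ b)) (α b))
        - fun b : PBond (F.P K) 0 => N' b.src - ((bgUnits F K U' b : (Matrix (Fin 2) (Fin 2) ℂ)ˣ) : Matrix (Fin 2) (Fin 2) ℂ) * N' b.tgt *
            (((bgUnits F K U' b)⁻¹ : (Matrix (Fin 2) (Fin 2) ℂ)ˣ) : Matrix (Fin 2) (Fin 2) ℂ)) = 0 := by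
  obtain ⟨N, hN, hQ⟩ := exists_gaugeDir_QSym_velocity_sub_eq_zero_of_slice_tangent_of_plaqSmall F h hε₀ he hWe hWε hε₀' hε' U₀ U' hreg hplaq' A₁ hA₁ hU' α hα
  -- both gauge directions have the same straight average: it reads `N ∘ x̂ = λ_α = N′ ∘ x̂` only
  have hG := QSym_gaugeDir_of_plaqSmall F h hε₀' hε' U' hplaq' N
  have hG' := QSym_gaugeDir_of_plaqSmall F h hε₀' hε' U' hplaq' N'
  have hGG : QSym F n K h U' (fun b : PBond (F.P K) 0 => N b.src - ((bgUnits F K U' b : (Matrix (Fin 2) (Fin 2) ℂ)ˣ) : Matrix (Fin 2) (Fin 2) ℂ) * N b.tgt *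
            (((bgUnits F K U' b)⁻¹ : (Matrix (Fin 2) (Fin 2) ℂ)ˣ) : Matrix (Fin 2) (Fin 2) ℂ))
      = QSym F n K h U' (fun b : PBond (F.P K) 0 => N' b.src - ((bgUnits F K U' b : (Matrix (Fin 2) (Fin 2) ℂ)ˣ) : Matrix (Fin 2) (Fin 2) ℂ) * N' b.tgt *
            (((bgUnits F K U' b)⁻¹ : (Matrix (Fin 2) (Fin 2) ℂ)ˣ) : Matrix (Fin 2) (Fin 2) ℂ)) := by
    rw [hG, hG']
    funext c
    rw [hN c.src, hN c.tgt, hN' c.src, hN' c.tgt]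
  rw [map_sub] at hQ ⊢
  rw [← hGG]
  exact hQ

/-- ★★ **AN `𝔰𝔲(2)`-VALUED GAUGE CORRECTION**: in T3's setting, if the frame response `λ_α(y)` is skew-Hermitian traceless at every comparison site (the «FRAME-RESPONSE-SU2» brick: the symmetric
accumulated frames are SU(2)-valued along real chart rays, ✓`Prop7SymFrameUnitary`), then there is an EVERYWHERE skew-Hermitian traceless fine gauge parameter `N` with
`QSym U′ (Mα − G_{U′}N) = 0` — so `Mα − G_{U′}N` is a legal (real) argument of the display's `hSplit′` once `Mα` is real.
[cite: Balaban1985Averaging, (11) p.19, (87) p.31, (97) p.32; Balaban1985Variational, (51) p.286, (82)-(83) p.290] -/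
theorem exists_su2_gaugeDir_QSym_velocity_sub_eq_zero_of_plaqSmall {ε₀ ε₀' e : ℝ} (hε₀ : 0 < ε₀) (he : 0 < e) (hWe : 10 ^ 9 * (F.L : ℝ) ^ 2 * e ≤ 1) (hWε : 10 ^ 12 * (F.L : ℝ) ^ 3 * ε₀ ≤ 1)
    (hε₀' : 0 < ε₀') (hε' : 10 ^ 7 * (F.L : ℝ) ^ 3 * ε₀' ≤ 1)
    (U₀ U' : GaugeField (F.P K) 0 (Matrix.specialUnitaryGroup (Fin 2) ℂ)) (hreg : RegPr F n K ε₀ U₀) (hplaq' : PlaqSmall (regThreshold F n K ε₀') U')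
    (A₁ : PBond (F.P K) 0 → Matrix (Fin 2) (Fin 2) ℂ) (hA₁ : ‖A₁‖ < e * eta F n K)
    (hU' : ∀ b, ((U' b : Matrix.specialUnitaryGroup (Fin 2) ℂ) : Matrix (Fin 2) (Fin 2) ℂ) = exp (A₁ b) * ((U₀ b : Matrix.specialUnitaryGroup (Fin 2) ℂ) : Matrix (Fin 2) (Fin 2) ℂ))
    (α : PBond (F.P K) 0 → Matrix (Fin 2) (Fin 2) ℂ) (hα : fderiv ℂ (logChartTwS F n K h U₀) A₁ α = 0)
    (hlamR : ∀ y : Site (F.P n) 0,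
      star (fderiv ℂ (fun A : PBond (F.P K) 0 → Matrix (Fin 2) (Fin 2) ℂ => ((frameTwS F n K h U₀ A y : (Matrix (Fin 2) (Fin 2) ℂ)ˣ) : Matrix (Fin 2) (Fin 2) ℂ)) A₁ α *
              (((frameTwS F n K h U₀ A₁ y)⁻¹ : (Matrix (Fin 2) (Fin 2) ℂ)ˣ) : Matrix (Fin 2) (Fin 2) ℂ))
        = -(fderiv ℂ (fun A : PBond (F.P K) 0 → Matrix (Fin 2) (Fin 2) ℂ => ((frameTwS F n K h U₀ A y : (Matrix (Fin 2) (Fin 2) ℂ)ˣ) : Matrix (Fin 2) (Fin 2) ℂ)) A₁ α *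
              (((frameTwS F n K h U₀ A₁ y)⁻¹ : (Matrix (Fin 2) (Fin 2) ℂ)ˣ) : Matrix (Fin 2) (Fin 2) ℂ)) ∧
      (fderiv ℂ (fun A : PBond (F.P K) 0 → Matrix (Fin 2) (Fin 2) ℂ => ((frameTwS F n K h U₀ A y : (Matrix (Fin 2) (Fin 2) ℂ)ˣ) : Matrix (Fin 2) (Fin 2) ℂ)) A₁ α *
              (((frameTwS F n K h U₀ A₁ y)⁻¹ : (Matrix (Fin 2) (Fin 2) ℂ)ˣ) : Matrix (Fin 2) (Fin 2) ℂ)).trace = 0) :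
    ∃ N : Site (F.P K) 0 → Matrix (Fin 2) (Fin 2) ℂ, (∀ x, star (N x) = -N x ∧ (N x).trace = 0) ∧
      QSym F n K h U' ((fun b : PBond (F.P K) 0 => gSer ℂ (ad ℂ (-A₁ b)) (α b))
          - fun b : PBond (F.P K) 0 => N b.src - ((bgUnits F K U' b : (Matrix (Fin 2) (Fin 2) ℂ)ˣ) : Matrix (Fin 2) (Fin 2) ℂ) * N b.tgt *
              (((bgUnits F K U' b)⁻¹ : (Matrix (Fin 2) (Fin 2) ℂ)ˣ) : Matrix (Fin 2) (Fin 2) ℂ)) = 0 := by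
  refine ⟨Function.extend (fun y : Site (F.P n) 0 => embIter (K - n) (siteShift (sites_eq F n K h) y))
      (fun y => fderiv ℂ (fun A : PBond (F.P K) 0 → Matrix (Fin 2) (Fin 2) ℂ => ((frameTwS F n K h U₀ A y : (Matrix (Fin 2) (Fin 2) ℂ)ˣ) : Matrix (Fin 2) (Fin 2) ℂ)) A₁ α *
              (((frameTwS F n K h U₀ A₁ y)⁻¹ : (Matrix (Fin 2) (Fin 2) ℂ)ˣ) : Matrix (Fin 2) (Fin 2) ℂ)) 0,
    extend_comparisonSite_skew_traceless F h _ hlamR, ?_⟩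
  exact QSym_velocity_sub_gaugeDir_eq_zero_of_extends_of_plaqSmall F h hε₀ he hWe hWε hε₀' hε' U₀ U' hreg hplaq' A₁ hA₁ hU' α hα _
    (fun y => extend_comparisonSite_apply F h _ y)

end Summit.QuantumFields.YangMills.Theorems.Prop7SliceChainOfPlaqSmall

end
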